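import Summits.QuantumFields.YangMills.Theorems.BalabanUVNodesK1V6Defs
import Summits.QuantumFields.YangMills.Theorems.BalabanUVNodesN17RunRemAtOfShiftAnchorLevel
import Summits.QuantumFields.YangMills.Theorems.BalabanUVNodesK1R8RowsDefs

/-!
# K1 v7ᴿ (ed.2, Variant Rʳ) — THE NEW REGISTERED STUB-3 TEXT `RunRowsContAtSomeRecord13PWS` AS A TREE DEFINITION (so that `stub_cont13` proofs and suppliers can be filed BY NAME),
# the by-name composition concluding K1⁸ `StabilityBRunRowsAtRecordR13SepCoPH`, and the witness-level adapters (the LEVEL-MATCHING in stub 3 is free; ONE run letter pays stubs 2″ AND 3)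

Cell `pub-ymgap`, WIDTH SEAT `pub-ymgap-dag-n24-w1` (gen 4; director-ym №197 ∕ HUMAN RULING D-0149).  `--kind definition --supports stmt-QuantumFields-26907 --as helper` (count-neutral).
Successor module of this seat's `Thm/BalabanUVNodesK1V6Defs.lean` (gen 2, p603819; the K1 v6 mirror) — SAME PATTERN, for the skeleton the plan registered on the NEW deciding crux after
director-ym №29 «PRESS Variant R» (chair R462; plan g84 rev 26 `29dee747fc28` ∕ rev 27 `12afebc05bbc`, 2026-08-28T08:07–08:09Z): K1⁸ `StabilityBRunRowsAtRecordR13SepCoPH` =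
stmt-QuantumFields-26907 (crux r3, DECIDING; K1⁷ stmt-QuantumFields-20542 → `aside`, history kept).
[I] = [Balaban1987RG1]; [II] = [Balaban1988RG2Cluster]; [III] = [Balaban1988Convergent]; [V] = [Balaban1989LargeFieldII]; [16] = [Balaban1985UV3]; [IV] = [Balaban1989LargeFieldI].

WHY.  Plan g84 registered skeleton «K1 v7ᴿ ed.2» on K1⁸ stmt-QuantumFields-26907 (2026-08-28T08:18:39Z; file `HOME/pub-ymgap-plan/D84-REV26R/k1v7R/K1Skeleton13SepCoPHv7R2.lean`,
skeleton sha `d90044cd05ffffb9…`, ns `…Theses.BalabanUVNodes.K1Skeleton13SepCoPHV7R`): stubs `stub_nodes13PWS : ∀ F : T4Family, Inhabited13 F → NodesAtSomeRecord13PWS F` and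
`stub_runRows13PWS : ∀ F : T4Family, NodesAtSomeRecord13PWS F → RunRowsAtSomeRecord13PWS F` (K1 v6's two texts BYTE-IDENTICAL — already tree definitions in `K1V6Defs`) and the NEW
★ `stub_cont13 : ∀ F : T4Family, RunRowsAtSomeRecord13PWS F → RunRowsContAtSomeRecord13PWS F` — rung 2″ ⟹ rung 2‴ := rung 2″ ∧ run-wise survivor continuity (C) `SurvCont β_θ γ₀` of
`β_θ := Node00.betaOfRecord₁₃ F 2 θ.toStage13Params` AT THE SAME witness `(θ, h, w)` AND THE SAME level `γ₀` as the rows (ym-nodeO IDEA-4 g12 F-B; [I] §1 pp.263–264: continuity of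
the effective-action coefficients in the couplings, asserted in print without proof).  The predicate `RunRowsContAtSomeRecord13PWS` is LOCAL to the skeleton file (plan's HOME, never
imported), so no tree file can yet spell the registered stub-3 text.  THIS FILE puts it into the tree BYTE-FOR-BYTE (v7ᴿ ed.2 l.240–246, over `K1V6Defs.RecordS`), composes K1⁸ BY
NAME from the three texts exactly as the skeleton's `k1R8_of_stubs` ∕ `StabilityBRunRowsAtRecordR13SepCoPH_proof` do, and supplies the witness-level adapters every stub-3 supplier
needs: (a) the LEVEL-MATCHING IS FREE — rows (i)–(iv) at level `γ₀` and (C) at ANY positive level `γc` on the same tuple give rung 2‴ at `min γ₀ γc` (dag-n17-w1's `survCont_anti`: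
(C) is ANTITONE in the level; DEF-1's `RunConstRemainder.mono`; the floor is antitone); (b) ONE run letter pays BOTH β-side stubs — ym-nodeO DEF-1's `RunRemAt F κ θ h c` (p596574;
K2⁷'s 2ᴮ″ currency) read ONE CONJUNCT FURTHER than v6's displayed adapter (`K1V6Defs.runRowsAtSomeRecord13PWS_of_runRemAt_drift_match` drops the letter's `SurvCont`): its
`SurvCont D.βfun γ₀` IS stub 3's (C) at the rows' own level, so «`RunRemAt` + bare drift + match `2c·stepBal 2 F.L + 2|c|A ≤ w.βup`» at the K1 witness gives rung 2‴ outright;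
(c) the ∃-side producer of this seat's p598782 §4 (`K1EndOfNodes13PWSOfRunRemAt.stabilityBAtRecordR13SepCoPH_of_rung1WithRunRowsAt`: rung 1 + `RunRemAt` + drift + match at the
witness ⟹ K1⁷ by name) is RE-POINTED to K1⁸ with its hypothesis VERBATIM — the conclusion upgrades for free because the run letter already carries (C).

CARVE-OUT (ym-nodeO DEF-1 g7 INTENT-9, bus l.31764, honoured): the per-tuple rows predicate `RunRowsCont13 F θ`, the ∀θ letter `Cont13All`, the supplier programme `RowsContAll`,
the `Iff.rfl` `stabilityBRunRowsAtRecordR13SepCoPH_iff` and «v6 texts + `Cont13All` ⟹ K1⁸» are DEF-1's `Thm/BalabanUVNodesK1R8RowsDefs.lean` (p616926 ✓, 08:27Z) — IMPORTED here, none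
re-declared; the by-name bridge «`Cont13All` ⟹ stub 3's text» (skeleton `stubCont13_of_cont13All`) is §2's `stub_cont13_of_cont13All` over DEF-1's `Cont13All`, and stub 3's text hands
DEF-1's per-tuple `RunRowsCont13 F θ` at its witness (`exists_runRowsCont13_of_runRowsContAtSomeRecord13PWS`).

CONTENTS.  §1 `RunRowsContAtSomeRecord13PWS` (v7ᴿ ed.2 text VERBATIM; docstring = the skeleton's, abridged).  §2 `runRowsAtSomeRecord13PWS_of_runRowsContAtSomeRecord13PWS`
(rung 2‴ ⟹ rung 2″) · `exists_runRowsCont13_of_runRowsContAtSomeRecord13PWS` (rung 2‴ ⟹ DEF-1's per-tuple rows at the witness) · `stub_cont13_of_cont13All` (DEF-1's `Cont13All` ⟹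
stub 3's text; = skeleton `stubCont13_of_cont13All`) · `stabilityBRunRowsAtRecordR13SepCoPH_of_stubTexts3` (the THREE registered texts ⟹ K1⁸ BY NAME; = the skeleton's composition) ·
`stabilityBRunRowsAtRecordR13SepCoPH_of_rung0_runRowsCont` (ONE producer «rung 0 ⟹ rung 2‴» ⟹ K1⁸) · `stabilityBAtRecordR13SepCoPH_of_stubTexts3` (the same three texts still
give the aside K1⁷, via `K1V6Defs`).  §3 witness adapters `runRowsContAt_of_runRowsAt_of_survCont` (level-free junction) · `runRowsContAt_of_runRowsAt_of_betaContH` (the box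
continuity letter `BetaContH` as (C) supplier) · `runRowsContAt_of_rung2At_of_survCont` (v5's interval binder + (C)) · `runRowsContAt_of_rung1At_of_absBox_of_runwisePS_of_survCont`
(K0⁷ 3ᴬ′'s |β| box + (PS) floor + (C): the β-side residue at a sign-free witness is «(PS) + (C)») · ★ `runRowsContAtSomeRecord13PWS_of_runRemAt_drift_match` · `runRowsContAtSomeRecord13PWS_of_remAt_drift_match` (ed.3's BOX
letter `RemAt`, via `runRemAt_of_remAt`).  §4 ★ `stabilityBRunRowsAtRecordR13SepCoPH_of_rung1WithRunRemAt` · `stabilityBRunRowsAtRecordR13SepCoPH_of_rung1WithRemAt` (route decl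
26907 BY NAME from ONE ∃-side producer, run ∕ box currency).

HONEST FRAMING.  One definition (a registered text VERBATIM), by-name compositions and four small adapters; NOTHING of Bałaban asserted; NO stub is proved here; nothing registered
or re-registered (the skeleton of record is the plan's v7ᴿ ed.2 — this file mirrors its new text so that proofs can be filed by name; if the plan re-cuts, this file is superseded,
not edited); K0⁷ stmt-QuantumFields-20541 ∕ K1⁸ stmt-QuantumFields-26907 ∕ K3⁷ stmt-QuantumFields-20544 OPEN; N24 COMPOSITE.  Counts unmoved (typed 28∕28 · discharged 5∕27
(A 5∕28)).  [I] §1 continuity and [B12] Thm 2 are unproved in print.  One finite 𝕋⁴ programme at fixed `ε = L^{−K}`, Bałaban AS PRINTED — NOT continuum ∕ ℝ⁴ ∕ OS ∕ mass gap ∕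
Clay: the Yang–Mills mass gap is NOT proved by any of this; route R4 closes the CONDITIONAL finite-𝕋⁴ rung `BalabanLadder.UV` only.  No `sorry`, `instance`, `notation`; standard axioms.
-/

noncomputable section

open scoped Matrix.Norms.L2Operator

namespace Summit.QuantumFields.YangMills.Theorems.K1V7RDefs

open Literature.MathematicalPhysics.QuantumFieldTheory.Balaban1983to89
open Literature.MathematicalPhysics.QuantumFieldTheory.Balaban1983to89.T4Continuum
open Literature.MathematicalPhysics.QuantumFieldTheory.Balaban1983to89.DagBinding
open FlowStepRuns
open FlowStep (HBeta RGEqH prefixOf BetaContH BetaLowerH BetaUpperH)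
open Summit.QuantumFields.YangMills.Theorems.BalabanUVNodesK2NamedJetsRunRemAt (RunRemAt RunConstRemainder SurvCont runwisePS_of_drift_runConstRemainder runRemAt_of_remAt)
open Summit.QuantumFields.YangMills.Theorems.BalabanUVNodesK2NamedJetsRemAt (RemAt band_of_drift)
open Summit.QuantumFields.YangMills.Theorems.BalabanUVNodesK2JsOfRecord (StepColourData beta0OfJs)
open Literature.MathematicalPhysics.QuantumFieldTheory.Balaban1983to89.Beta.Drift (OneLoopDrift)
open Summit.QuantumFields.YangMills.Theorems.EndpointGivenBR13SepCoPH.Negative.RemNamedJets13FalseOfTwoNormalisations (oneLoopDrift_const_mul)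
open Summit.QuantumFields.YangMills.BalabanUVNodes.K1EndOfNodes13PWSOfRunRemAt (stabilityB_body_of_rung1At_of_runLetters)
open Summit.QuantumFields.YangMills.BalabanUVNodes.N17RunRemAtOfShiftAnchorLevel (survCont_anti)
open Summit.QuantumFields.YangMills.BalabanUVNodes.K1RunRowsOfBoxAndPartialSums (runConstRemainder_of_twoSided_alongRuns runConstRemainder_of_boxBounds
  runwisePS_of_lower_alongRuns_nonneg bounds_alongRGEqH_of_betaBoundsInInterval)
open Summit.QuantumFields.YangMills.Theorems.K1V6Defs (RecordS Inhabited13 NodesAtSomeRecord13PWS RunRowsAtSomeRecord13PWS Window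
  stabilityBAtRecordR13SepCoPH_of_stubTexts)
open Summit.QuantumFields.YangMills.Theorems.BalabanUVNodesK1R8RowsDefs (RunRowsCont13 Cont13All runRowsCont13_intro)

/-! ## §1 The v7ᴿ ed.2 stub-3 text, verbatim -/

/-- **rung 2‴ (v7ᴿ ed.2 l.240–246 VERBATIM, RUN CURRENCY + (C); = ym-nodeO IDEA-4 g12 `RunRowsContAtSomeRecord13PWS`)**: rung 2″'s text (`K1V6Defs.RunRowsAtSomeRecord13PWS F`,
byte-identical prefix) with ONE more conjunct — run-wise SURVIVOR CONTINUITY `SurvCont β_θ γ₀` of `β_θ := Node00.betaOfRecord₁₃ F 2 θ.toStage13Params` AT THE SAME witness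
`(θ, h, w)` and THE SAME level `γ₀` as the rows (i)–(iv).  `b r γ₀ B M` free (∃-side).  (= the conclusion of registered stub `stub_cont13`; the rows (i)(iv) + (C) are exactly what
the END road of record reads, dag-n13-w4's `K1WindowKOfRunRowsSurvivors.endpointExistence_datumOfRecord₁₃SepCoPH_of_runRows_survCont`.)
[cite: Balaban1987RG1, Thm 3 p.264, (1.20)–(1.22) p.264, (5.10) p.293, §1 pp.263–264; Balaban1988RG2Cluster, (2.41) p.21 (statement shape only; bookkeeping)] -/
def RunRowsContAtSomeRecord13PWS (F : T4Family) : Prop :=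
  ∃ (θ : Node00.Stage13HParams F 2) (h : θ.Provisos₁₃SepCoPH F 2) (w : WorldP), (θ.ZhUnity F 2 ∧ θ.SlotsNondegenerate₁₃ F 2) ∧ θ.Admissible F 2 ∧
    RecordS F θ h w ∧ (∀ P : B12.RunParams, Nodes (leavesP w P)) ∧
    ∃ (b : ℕ → ℝ) (r γ₀ B M : ℝ), 0 < γ₀ ∧ RunConstRemainder (Node00.betaOfRecord₁₃ F 2 θ.toStage13Params) b r γ₀ ∧ (∀ k, b k ≤ B) ∧ B + r ≤ w.βup ∧
      (∀ (n : ℕ) (gs : ℕ → ℝ), RGEqH n (Node00.betaOfRecord₁₃ F 2 θ.toStage13Params) gs → Step.InInterval γ₀ n gs →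
        ∀ k, k ≤ n → -M ≤ ∑ j ∈ Finset.Ico k n, Node00.betaOfRecord₁₃ F 2 θ.toStage13Params j (prefixOf gs j)) ∧
      SurvCont (Node00.betaOfRecord₁₃ F 2 θ.toStage13Params) γ₀

/-! ## §2 The by-name compositions -/

/-- rung 2‴ ⟹ rung 2″ (drop (C)): every stub-3 witness is a stub-2″ witness. [cite: Balaban1987RG1, Thm 3 p.264 (bookkeeping)] -/
theorem runRowsAtSomeRecord13PWS_of_runRowsContAtSomeRecord13PWS (F : T4Family) (h : RunRowsContAtSomeRecord13PWS F) : RunRowsAtSomeRecord13PWS F := by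
  obtain ⟨θ, hP, w, hU, hθ, hR, hnodes, b, r, γ₀, B, M, hγ₀, hrem, hB, hmatch, hps, -⟩ := h
  exact ⟨θ, hP, w, hU, hθ, hR, hnodes, b, r, γ₀, B, M, hγ₀, hrem, hB, hmatch, hps⟩

/-- rung 2‴ ⟹ DEF-1's PER-TUPLE ROWS `RunRowsCont13 F θ` (p616926, = plan g84 `Sketch26R` :40 — rows (i)(iv)+(C), the K1⁸ item's own conjunct shape) AT THE WITNESS, together with
the rung-1 data there (the bound `b ≤ B` and the ceiling match are dropped: they serve (B) and the window, not the END). [cite: Balaban1987RG1, Thm 3 p.264, §1 pp.263–264 (bookkeeping)] -/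
theorem exists_runRowsCont13_of_runRowsContAtSomeRecord13PWS (F : T4Family) (h : RunRowsContAtSomeRecord13PWS F) :
    ∃ (θ : Node00.Stage13HParams F 2) (h : θ.Provisos₁₃SepCoPH F 2) (w : WorldP), (θ.ZhUnity F 2 ∧ θ.SlotsNondegenerate₁₃ F 2) ∧ θ.Admissible F 2 ∧
      RecordS F θ h w ∧ (∀ P : B12.RunParams, Nodes (leavesP w P)) ∧ RunRowsCont13 F θ := by
  obtain ⟨θ, hP, w, hU, hθ, hR, hnodes, b, r, γ₀, B, M, hγ₀, hrem, -, -, hps, hsc⟩ := h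
  exact ⟨θ, hP, w, hU, hθ, hR, hnodes, runRowsCont13_intro θ hγ₀ hrem hps hsc⟩

/-- **DEF-1's ∀θ LETTER `Cont13All` ⟹ STUB 3's TEXT** (= the skeleton's kernel bridge `stubCont13_of_cont13All`, over the tree names): at a rows witness `(θ, h, w)` read (C) at the admissible
PRESENTING tuple `θ'` of `RecordS` (same datum ⟹ same β of record, `Node00.βfun_datumOfRecord₁₃SepCoPH`) at the level `min γ₀ w.γ ≤ θ'.γ`, and cut the rows to that level
(`RunConstRemainder.mono`; the floor is antitone in the level).  So a proof of `Cont13All` closes the registered `stub_cont13` BY NAME through this theorem.  CONDITIONAL on `hC`.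
[cite: Balaban1987RG1, §1 pp.263–264, Thm 3 p.264 (bookkeeping)] -/
theorem stub_cont13_of_cont13All (hC : Cont13All) : ∀ F : T4Family, RunRowsAtSomeRecord13PWS F → RunRowsContAtSomeRecord13PWS F := by
  intro F hrows
  obtain ⟨θ, h, w, hU, hθ, hR, hnodes, b, r, γ₀, B, M, hγ₀, hrem, hB, hmatch, hps⟩ := hrows
  obtain ⟨θ', h', hθ'adm, hD, hC', ⟨hwγ, hwγle⟩, hL, hup⟩ := hR
  have hγ₁ : 0 < min γ₀ w.γ := lt_min hγ₀ hwγ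
  have hγ₁le : min γ₀ w.γ ≤ θ'.γ := (min_le_right _ _).trans hwγle
  have hβ : Node00.betaOfRecord₁₃ F 2 θ'.toStage13Params = Node00.betaOfRecord₁₃ F 2 θ.toStage13Params := by
    have := congrArg (fun D => D.βfun) hD
    simpa [Node00.βfun_datumOfRecord₁₃SepCoPH] using this.symm
  have hsc : SurvCont (Node00.betaOfRecord₁₃ F 2 θ.toStage13Params) (min γ₀ w.γ) := by
    have := hC F θ' h' hθ'adm (min γ₀ w.γ) hγ₁ hγ₁le
    rwa [hβ] at this
  refine ⟨θ, h, w, hU, hθ, ⟨θ', h', hθ'adm, hD, hC', ⟨hwγ, hwγle⟩, hL, hup⟩, hnodes, b, r, min γ₀ w.γ, B, M, hγ₁, hrem.mono (min_le_left _ _), hB, hmatch, ?_, hsc⟩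
  intro n gs hrg hI k hk
  exact hps n gs hrg (fun j hj => ⟨(hI j hj).1, (hI j hj).2.trans (min_le_left _ _)⟩) k hk

/-- **K1⁸ stmt-QuantumFields-26907 BY NAME FROM ONE PRODUCER «rung 0 ⟹ rung 2‴»** (any road from K0⁷'s conclusion on `F` to a rows∕(C) witness; the three stubs composed are
one such): (B) and the `K ≥ 1` window at the witness by this seat's θ-keyed run-letter END road `K1EndOfNodes13PWSOfRunRemAt.stabilityB_body_of_rung1At_of_runLetters` (p598782 §2),
the rows (i)(iv) and (C) read off the bundle (the route decl inlines the bodies of `RunConstRemainder` ∕ `SurvCont` ∕ `Survivors`; definitional).  CONDITIONAL on `h`; K1⁸ OPEN.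
[cite: Balaban1989LargeFieldII, Thm 1 p.355 + (0.1) pp.355–356 + p.391; Balaban1987RG1, Thm 3 p.264, (5.10) p.293, §1 pp.263–264; Balaban1988Convergent, (2.6) p.255, Cor. 3 (2.50) p.264 (bookkeeping)] -/
theorem stabilityBRunRowsAtRecordR13SepCoPH_of_rung0_runRowsCont (h : ∀ F : T4Family, Inhabited13 F → RunRowsContAtSomeRecord13PWS F) :
    Summit.QuantumFields.YangMills.Theses.BalabanUVNodes.StabilityBRunRowsAtRecordR13SepCoPH := by
  intro F hinh
  obtain ⟨θ, hP, w, hU, hθ, hR, hnodes, b, r, γ₀, B, M, hγ₀, hrem, hB, hmatch, hps, hsc⟩ := h F hinh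
  obtain ⟨hU', hθ', hb, hwin⟩ := stabilityB_body_of_rung1At_of_runLetters θ hP w hU hθ hR hnodes hγ₀ hrem hB hmatch hps
  exact ⟨θ, hP, hU', hθ', hb, hwin, b, r, γ₀, M, hγ₀, hrem, hps, hsc⟩

/-- **★ K1⁸ stmt-QuantumFields-26907 BY NAME FROM THE THREE REGISTERED v7ᴿ STUB TEXTS** (`h₁` = `stub_nodes13PWS`'s text, `h₂` = `stub_runRows13PWS`'s text, `h₃` = `stub_cont13`'s
text): the skeleton's composition `k1R8_of_stubs` over the named predicates, concluded BY NAME.  CONDITIONAL on the three texts (none proved here); K1⁸ OPEN.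
[cite: Balaban1989LargeFieldII, Thm 1 p.355 + (0.1) pp.355–356 + p.391; Balaban1987RG1, Thm 3 p.264, (5.10) p.293, §1 pp.263–264; Balaban1988Convergent, (2.6) p.255, Cor. 3 (2.50) p.264 (bookkeeping)] -/
theorem stabilityBRunRowsAtRecordR13SepCoPH_of_stubTexts3
    (h₁ : ∀ F : T4Family, Inhabited13 F → NodesAtSomeRecord13PWS F)
    (h₂ : ∀ F : T4Family, NodesAtSomeRecord13PWS F → RunRowsAtSomeRecord13PWS F)
    (h₃ : ∀ F : T4Family, RunRowsAtSomeRecord13PWS F → RunRowsContAtSomeRecord13PWS F) :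
    Summit.QuantumFields.YangMills.Theses.BalabanUVNodes.StabilityBRunRowsAtRecordR13SepCoPH :=
  stabilityBRunRowsAtRecordR13SepCoPH_of_rung0_runRowsCont fun F hF => h₃ F (h₂ F (h₁ F hF))

/-- **THE SAME THREE TEXTS STILL GIVE THE ASIDE K1⁷ stmt-QuantumFields-20542** (history item; `K1V6Defs.stabilityBAtRecordR13SepCoPH_of_stubTexts` after dropping (C)) — so a v7ᴿ
stub set closes BOTH the deciding K1⁸ and its predecessor text.  CONDITIONAL; neither item is closed here. [cite: Balaban1989LargeFieldII, Thm 1 p.355 (bookkeeping)] -/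
theorem stabilityBAtRecordR13SepCoPH_of_stubTexts3
    (h₁ : ∀ F : T4Family, Inhabited13 F → NodesAtSomeRecord13PWS F)
    (h₂ : ∀ F : T4Family, NodesAtSomeRecord13PWS F → RunRowsAtSomeRecord13PWS F)
    (_h₃ : ∀ F : T4Family, RunRowsAtSomeRecord13PWS F → RunRowsContAtSomeRecord13PWS F) :
    Summit.QuantumFields.YangMills.Theses.BalabanUVNodes.StabilityBAtRecordR13SepCoPH :=
  stabilityBAtRecordR13SepCoPH_of_stubTexts h₁ h₂

/-! ## §3 Witness-level adapters: the level-matching in stub 3 is free; ONE run letter pays stubs 2″ and 3 -/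

section Witness

variable {F : T4Family}

/-- **★ THE LEVEL-FREE JUNCTION**: at rung-1 data `(θ, h, w)` (unity ∧ slots, admissibility, an S-bound world of the datum with the thirteen nodes at every run), the rows (i)–(iv) of
`β_θ` at SOME level `γ₀ > 0` AND run-wise survivor continuity `SurvCont β_θ γc` at ANY level `γc > 0` give rung 2‴ — at the level `min γ₀ γc`: DEF-1's `RunConstRemainder.mono`, the
floor restricted to the in-window runs of the smaller level, and dag-n17-w1's `survCont_anti` ((C) is ANTITONE in the level: a survivor of a smaller level is a survivor of the larger
one with the same clamped prefix).  So a stub-3 supplier may bring (C) at its OWN level; no agreement with the rows' level is asked. [cite: Balaban1987RG1, Thm 3 p.264, (1.22) p.264, §1 pp.263–264 (bookkeeping)] -/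
theorem runRowsContAt_of_runRowsAt_of_survCont (θ : Node00.Stage13HParams F 2) (h : θ.Provisos₁₃SepCoPH F 2) (w : WorldP)
    (hU : θ.ZhUnity F 2 ∧ θ.SlotsNondegenerate₁₃ F 2) (hθ : θ.Admissible F 2) (hR : RecordS F θ h w) (hnodes : ∀ P : B12.RunParams, Nodes (leavesP w P))
    {b : ℕ → ℝ} {r γ₀ B M : ℝ} (hγ₀ : 0 < γ₀) (hrem : RunConstRemainder (Node00.betaOfRecord₁₃ F 2 θ.toStage13Params) b r γ₀) (hB : ∀ k, b k ≤ B) (hmatch : B + r ≤ w.βup)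
    (hps : ∀ (n : ℕ) (gs : ℕ → ℝ), RGEqH n (Node00.betaOfRecord₁₃ F 2 θ.toStage13Params) gs → Step.InInterval γ₀ n gs →
      ∀ k, k ≤ n → -M ≤ ∑ j ∈ Finset.Ico k n, Node00.betaOfRecord₁₃ F 2 θ.toStage13Params j (prefixOf gs j))
    {γc : ℝ} (hγc : 0 < γc) (hsc : SurvCont (Node00.betaOfRecord₁₃ F 2 θ.toStage13Params) γc) : RunRowsContAtSomeRecord13PWS F := by
  refine ⟨θ, h, w, hU, hθ, hR, hnodes, b, r, min γ₀ γc, B, M, lt_min hγ₀ hγc, hrem.mono (min_le_left _ _), hB, hmatch, ?_,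
    survCont_anti (lt_min hγ₀ hγc) (min_le_right _ _) hsc⟩
  intro n gs hrg hI k hk
  exact hps n gs hrg (fun j hj => ⟨(hI j hj).1, (hI j hj).2.trans (min_le_left _ _)⟩) k hk

/-- **THE BOX CONTINUITY LETTER AS (C) SUPPLIER**: the same junction with `BetaContH γc β_θ` (continuity of each `β_θ k` on the history box of level `γc` — the binder currency of
N26 ∕ `FlowStep` :103) in place of `SurvCont`, through DEF-1's `SurvCont.of_betaContH`. [cite: Balaban1987RG1, §1 pp.263–264, (1.22) p.264 (bookkeeping)] -/
theorem runRowsContAt_of_runRowsAt_of_betaContH (θ : Node00.Stage13HParams F 2) (h : θ.Provisos₁₃SepCoPH F 2) (w : WorldP)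
    (hU : θ.ZhUnity F 2 ∧ θ.SlotsNondegenerate₁₃ F 2) (hθ : θ.Admissible F 2) (hR : RecordS F θ h w) (hnodes : ∀ P : B12.RunParams, Nodes (leavesP w P))
    {b : ℕ → ℝ} {r γ₀ B M : ℝ} (hγ₀ : 0 < γ₀) (hrem : RunConstRemainder (Node00.betaOfRecord₁₃ F 2 θ.toStage13Params) b r γ₀) (hB : ∀ k, b k ≤ B) (hmatch : B + r ≤ w.βup)
    (hps : ∀ (n : ℕ) (gs : ℕ → ℝ), RGEqH n (Node00.betaOfRecord₁₃ F 2 θ.toStage13Params) gs → Step.InInterval γ₀ n gs →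
      ∀ k, k ≤ n → -M ≤ ∑ j ∈ Finset.Ico k n, Node00.betaOfRecord₁₃ F 2 θ.toStage13Params j (prefixOf gs j))
    {γc : ℝ} (hγc : 0 < γc) (hcont : BetaContH γc (Node00.betaOfRecord₁₃ F 2 θ.toStage13Params)) : RunRowsContAtSomeRecord13PWS F :=
  runRowsContAt_of_runRowsAt_of_survCont θ h w hU hθ hR hnodes hγ₀ hrem hB hmatch hps hγc (SurvCont.of_betaContH hγc hcont)

/-- **v5's RUNG 2 + (C) ⟹ RUNG 2‴ AT THE SAME WITNESS** (this seat's p602861 `K1RunRowsOfBoxAndPartialSums.runRowsAt_of_rung2At` read with a continuity letter): v5's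
interval binder `BetaBoundsInInterval w.C.toB12 w.γ w.b w.βup` at the S-bound world ([I] (1.22) p.264; pointwise floor `w.b > 0` printed nowhere, T09.F) gives the rows at level `w.γ`
(`b :≡ (w.b+w.βup)∕2`, `r := (w.βup−w.b)∕2`, `B + r = w.βup`, `M := 0`; the binder read along every (0.20)-solution by forward uniqueness, `bounds_alongRGEqH_of_betaBoundsInInterval`);
with `SurvCont β_θ γc` at any level the junction above gives rung 2‴.  So every supplier of the POINTWISE road still serves v7ᴿ's stub pair, given (C). [cite: Balaban1987RG1, §1 (1.22) p.264, Thm 3 p.264, §1 pp.263–264 (bookkeeping)] -/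
theorem runRowsContAt_of_rung2At_of_survCont (θ : Node00.Stage13HParams F 2) (h : θ.Provisos₁₃SepCoPH F 2) (w : WorldP)
    (hU : θ.ZhUnity F 2 ∧ θ.SlotsNondegenerate₁₃ F 2) (hθ : θ.Admissible F 2) (hR : RecordS F θ h w) (hnodes : ∀ P : B12.RunParams, Nodes (leavesP w P))
    (hβ : BetaBoundsInInterval w.C.toB12 w.γ w.b w.βup)
    {γc : ℝ} (hγc : 0 < γc) (hsc : SurvCont (Node00.betaOfRecord₁₃ F 2 θ.toStage13Params) γc) : RunRowsContAtSomeRecord13PWS F := by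
  obtain ⟨θ', h', hθ', hD, hC, hγ, hL, hup⟩ := hR
  have hβ' : BetaBoundsInInterval (Node00.datumOfRecord₁₃SepCoPH F 2 θ h).C.toB12 w.γ w.b w.βup := by
    have e : (Node00.datumOfRecord₁₃SepCoPH F 2 θ h).C.toB12 = w.C.toB12 := by rw [hC]
    rw [e]; exact hβ
  have hb2 := bounds_alongRGEqH_of_betaBoundsInInterval (Node00.datumOfRecord₁₃SepCoPH F 2 θ h).C.toB12 (Node00.betaOfRecord₁₃ F 2 θ.toStage13Params)
    (Node00.datumOfRecord₁₃SepCoPH F 2 θ h).fwd (Node00.datumOfRecord₁₃SepCoPH F 2 θ h).curries hβ' F.m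
  exact runRowsContAt_of_runRowsAt_of_survCont θ h w hU hθ ⟨θ', h', hθ', hD, hC, hγ, hL, hup⟩ hnodes (B := (w.b + w.βup) / 2) (M := 0) hγ.1
    (runConstRemainder_of_twoSided_alongRuns hb2) (fun _ => le_rfl) (le_of_eq (by ring))
    (runwisePS_of_lower_alongRuns_nonneg w.b_pos.le fun n gs hrg hI k hk => (hb2 n gs hrg hI k hk).1) hγc hsc

/-- **★ AT A WITNESS CARRYING A SIGN-FREE |β| BOX, v7ᴿ's β-SIDE STUB PAIR IS «RUN-WISE (PS) FLOOR + (C)»** (p602861 `runRowsAt_of_rung1At_of_absBox_of_runwisePS` read with a continuity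
letter): rung-1 data at `(θ, h, w)` + a box `BetaLowerH (−β′) γ₀ β_θ ∧ BetaUpperH β′ γ₀ β_θ` (K0⁷ stub 3ᴬ′'s currency: [I] §1 p.264 ∕ Thm 2 «uniformly bounded», NO SIGN) + the match
`β′ ≤ w.βup` + the run-wise (PS) floor with defect `M` on that level + `SurvCont β_θ γc` at ANY level `γc > 0` ⊢ rung 2‴ (`b :≡ 0`, `r := β′`, `B := 0`, level `min γ₀ γc`).  So, given 3ᴬ′ and
a world built with `w.βup ≥ β′` (as dag-n24-c's closers do), the TWO registered β-side stubs ask at that witness EXACTLY «partial sums of `β_θ` along in-window (0.20)-runs bounded below»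
([II] (2.41)-class content) AND «run-wise survivor continuity of `β_θ` at some positive level» ([I] §1 pp.263–264) — nothing else.  CONDITIONAL; closes nothing.
[cite: Balaban1987RG1, §1 (1.22) p.264, Thm 2 p.259, Thm 3 p.264, §1 pp.263–264; Balaban1988RG2Cluster, (2.41) p.21 (bookkeeping)] -/
theorem runRowsContAt_of_rung1At_of_absBox_of_runwisePS_of_survCont (θ : Node00.Stage13HParams F 2) (h : θ.Provisos₁₃SepCoPH F 2) (w : WorldP)
    (hU : θ.ZhUnity F 2 ∧ θ.SlotsNondegenerate₁₃ F 2) (hθ : θ.Admissible F 2) (hR : RecordS F θ h w) (hnodes : ∀ P : B12.RunParams, Nodes (leavesP w P))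
    {γ₀ β' M : ℝ} (hγ₀ : 0 < γ₀) (hlow : BetaLowerH (-β') γ₀ (Node00.betaOfRecord₁₃ F 2 θ.toStage13Params)) (hup : BetaUpperH β' γ₀ (Node00.betaOfRecord₁₃ F 2 θ.toStage13Params))
    (hmatch : β' ≤ w.βup)
    (hps : ∀ (n : ℕ) (gs : ℕ → ℝ), RGEqH n (Node00.betaOfRecord₁₃ F 2 θ.toStage13Params) gs → Step.InInterval γ₀ n gs →
      ∀ k, k ≤ n → -M ≤ ∑ j ∈ Finset.Ico k n, Node00.betaOfRecord₁₃ F 2 θ.toStage13Params j (prefixOf gs j))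
    {γc : ℝ} (hγc : 0 < γc) (hsc : SurvCont (Node00.betaOfRecord₁₃ F 2 θ.toStage13Params) γc) : RunRowsContAtSomeRecord13PWS F := by
  have hrem := runConstRemainder_of_boxBounds hlow hup
  have e1 : (-β' + β') / 2 = (0 : ℝ) := by ring
  have e2 : (β' - -β') / 2 = β' := by ring
  rw [e1, e2] at hrem
  exact runRowsContAt_of_runRowsAt_of_survCont θ h w hU hθ hR hnodes (B := 0) hγ₀ hrem (fun _ => le_rfl) (by linarith) hps hγc hsc

/-- **★ ONE RUN LETTER PAYS STUBS 2″ AND 3 (v6's displayed adapter read one conjunct further)**: at rung-1 data `(θ, h, w)`, ym-nodeO DEF-1's run edition `RunRemAt F κ θ h c` (p596574: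
on SOME level `γ₀ ≤ θ.γ`, the run-wise constant remainder of the datum's `βfun` = `β_θ` (`Node00.βfun_datumOfRecord₁₃SepCoPH`, `rfl`) relative to `c • beta0OfJs F κ` with cap
`s ≤ c·stepBal 2 F.L`, the box anchor (UNREAD), AND `SurvCont D.βfun γ₀`), the bare drift `OneLoopDrift (stepBal 2 F.L) A (beta0OfJs F κ)` rescaled by `oneLoopDrift_const_mul`, band
`c·b_k ≤ c·stepBal 2 F.L + 2|c|A` (`band_of_drift`), run-wise (PS) with `M := 2|c|A` (`runwisePS_of_drift_runConstRemainder`), and the numeric match `2c·stepBal 2 F.L + 2|c|A ≤ w.βup`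
⊢ rung 2‴ AT THE LETTER'S OWN LEVEL — the (C) conjunct v6's adapter discarded is exactly stub 3's.  So the K2⁷ 2ᴮ″-currency supplier at the K1 witness serves `stub_runRows13PWS` and
`stub_cont13` at once. [cite: Balaban1987RG1, Thm 3 p.264, (1.20)–(1.22) p.264, (2.12)–(2.14) p.268, (5.10) p.293, §1 pp.263–264 (bookkeeping)] -/
theorem runRowsContAtSomeRecord13PWS_of_runRemAt_drift_match (θ : Node00.Stage13HParams F 2) (h : θ.Provisos₁₃SepCoPH F 2) (w : WorldP)
    (hU : θ.ZhUnity F 2 ∧ θ.SlotsNondegenerate₁₃ F 2) (hθ : θ.Admissible F 2) (hR : RecordS F θ h w) (hnodes : ∀ P : B12.RunParams, Nodes (leavesP w P))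
    (κ : StepColourData) {c A : ℝ} (hRun : RunRemAt F κ θ h c) (hdrift : OneLoopDrift (B12Normalization.stepBal 2 F.L) A (beta0OfJs F κ))
    (hmatch : 2 * (c * B12Normalization.stepBal 2 F.L) + 2 * (|c| * A) ≤ w.βup) : RunRowsContAtSomeRecord13PWS F := by
  obtain ⟨γ₀, s, hγ₀, -, hcap, hrem, -, hsc⟩ := hRun
  have hd := oneLoopDrift_const_mul hdrift c
  have hband : ∀ k, c * beta0OfJs F κ k ≤ c * B12Normalization.stepBal 2 F.L + 2 * (|c| * A) := fun k => by
    have := (abs_le.mp (band_of_drift hd k)).2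
    linarith
  have hmatch' : c * B12Normalization.stepBal 2 F.L + 2 * (|c| * A) + s ≤ w.βup := by linarith
  exact ⟨θ, h, w, hU, hθ, hR, hnodes, fun k => c * beta0OfJs F κ k, s, γ₀, _, _, hγ₀, hrem, hband, hmatch', runwisePS_of_drift_runConstRemainder hd hrem hcap, hsc⟩

/-- **THE BOX LETTER IS A SPECIAL CASE**: ed.3's box edition `RemAt F κ θ h c` (p593586; this seat's g0 E3 currency) restricts to the run edition (DEF-1's `runRemAt_of_remAt`), so with
the drift and the match it, too, gives rung 2‴ at the witness. [cite: Balaban1987RG1, (1.20)–(1.22) p.264, (2.12)–(2.14) p.268, §1 pp.263–264 (bookkeeping)] -/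
theorem runRowsContAtSomeRecord13PWS_of_remAt_drift_match (θ : Node00.Stage13HParams F 2) (h : θ.Provisos₁₃SepCoPH F 2) (w : WorldP)
    (hU : θ.ZhUnity F 2 ∧ θ.SlotsNondegenerate₁₃ F 2) (hθ : θ.Admissible F 2) (hR : RecordS F θ h w) (hnodes : ∀ P : B12.RunParams, Nodes (leavesP w P))
    (κ : StepColourData) {c A : ℝ} (hRem : RemAt F κ θ h c) (hdrift : OneLoopDrift (B12Normalization.stepBal 2 F.L) A (beta0OfJs F κ))
    (hmatch : 2 * (c * B12Normalization.stepBal 2 F.L) + 2 * (|c| * A) ≤ w.βup) : RunRowsContAtSomeRecord13PWS F :=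
  runRowsContAtSomeRecord13PWS_of_runRemAt_drift_match θ h w hU hθ hR hnodes κ (runRemAt_of_remAt F κ θ h hRem) hdrift hmatch

end Witness

/-! ## §4 The route decl K1⁸ BY NAME from ONE ∃-side producer «rung 1 WITH the run letter at the witness» (p598782 §4 re-pointed K1⁷ → K1⁸) -/

section Registered

/-- **★ K1⁸ stmt-QuantumFields-26907 BY NAME FROM ONE ∃-SIDE PRODUCER «RUNG 1 WITH THE RUN LETTER AT THE WITNESS»** — hypothesis `h` VERBATIM that of this seat's K1⁷ producer
`K1EndOfNodes13PWSOfRunRemAt.stabilityBAtRecordR13SepCoPH_of_rung1WithRunRowsAt` (p598782 §4): for every family with a unity Stage-13 tuple (K0⁷'s conclusion), SOME unity tuple `θ`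
with provisos carries at SOME scale `c` and colour datum `κ` the run letter `RunRemAt F κ θ h c` with the bare drift of the named numbers (defect `A`), and an S-bound world of its datum
(`RecordS`, spelled out) whose ceiling clears `2c·stepBal 2 F.L + 2|c|A` and all of whose runs' leaf worlds satisfy the thirteen DAG nodes.  Conclusion UPGRADED from K1⁷ to K1⁸
(`…Theses.BalabanUVNodes.StabilityBRunRowsAtRecordR13SepCoPH`, the TYPE is the route decl literally) at no extra cost: the run letter's own (C) conjunct is stub 3's.  CONDITIONAL on
`h` (not supplied here); K1⁸ NOT closed by this theorem; nothing of Bałaban asserted; no count moved.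
[cite: Balaban1989LargeFieldII, Thm 1 p.355 + (0.1) pp.355–356 + p.391; Balaban1987RG1, Thm 2 p.259, Thm 3 p.264, (1.20)–(1.22) p.264, (2.12)–(2.14) p.268, (5.10) p.293, §1 pp.263–264; Balaban1988Convergent, (2.6) p.255 and Cor. 3 (2.50) p.264 (bookkeeping)] -/
theorem stabilityBRunRowsAtRecordR13SepCoPH_of_rung1WithRunRemAt
    (h : ∀ F : T4Family, (∃ θ : Node00.Stage13HParams F 2, θ.Provisos₁₃SepCoPH F 2 ∧ (θ.ZhUnity F 2 ∧ θ.SlotsNondegenerate₁₃ F 2) ∧ θ.Admissible F 2) →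
      ∃ (θ : Node00.Stage13HParams F 2) (h : θ.Provisos₁₃SepCoPH F 2), (θ.ZhUnity F 2 ∧ θ.SlotsNondegenerate₁₃ F 2) ∧ θ.Admissible F 2 ∧
        ∃ (κ : StepColourData) (c A : ℝ), RunRemAt F κ θ h c ∧ OneLoopDrift (B12Normalization.stepBal 2 F.L) A (beta0OfJs F κ) ∧
          ∃ w : WorldP, 2 * (c * B12Normalization.stepBal 2 F.L) + 2 * (|c| * A) ≤ w.βup ∧
            (∃ (θ' : Node00.Stage13HParams F 2) (h' : θ'.Provisos₁₃SepCoPH F 2), θ'.Admissible F 2 ∧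
              Node00.datumOfRecord₁₃SepCoPH F 2 θ h = Node00.datumOfRecord₁₃SepCoPH F 2 θ' h' ∧ w.C = (Node00.datumOfRecord₁₃SepCoPH F 2 θ h).C ∧ (0 < w.γ ∧ w.γ ≤ θ'.γ) ∧
              w.L = (θ'.L : ℝ) ∧ ∀ P : B12.RunParams, w.up P = Node00.upOfRecord₅CS F 2 (θ'.toStage5₁₃CoPH F 2) P) ∧
            ∀ P : B12.RunParams, Nodes (leavesP w P)) :
    Summit.QuantumFields.YangMills.Theses.BalabanUVNodes.StabilityBRunRowsAtRecordR13SepCoPH :=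
  stabilityBRunRowsAtRecordR13SepCoPH_of_rung0_runRowsCont fun F hinh => by
    obtain ⟨θ, hP, hU, hθ, κ, c, A, hRun, hdrift, w, hmatch, hR, hnodes⟩ := h F hinh
    exact runRowsContAtSomeRecord13PWS_of_runRemAt_drift_match θ hP w hU hθ hR hnodes κ hRun hdrift hmatch

/-- **THE BOX-CURRENCY PRODUCER IS A SPECIAL CASE** (p598782 §4 `…_of_rung1WithBoxRowsAt` re-pointed): the same ∃-side producer with ed.3's BOX letter `RemAt F κ θ h c` (g0's E3
currency, p595293) also gives K1⁸ BY NAME (`runRemAt_of_remAt`).  CONDITIONAL; K1⁸ NOT closed by this theorem.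
[cite: Balaban1989LargeFieldII, Thm 1 p.355 + (0.1) pp.355–356; Balaban1987RG1, Thm 2 p.259, (1.20)–(1.22) p.264, (2.12)–(2.14) p.268, §1 pp.263–264 (bookkeeping)] -/
theorem stabilityBRunRowsAtRecordR13SepCoPH_of_rung1WithRemAt
    (h : ∀ F : T4Family, (∃ θ : Node00.Stage13HParams F 2, θ.Provisos₁₃SepCoPH F 2 ∧ (θ.ZhUnity F 2 ∧ θ.SlotsNondegenerate₁₃ F 2) ∧ θ.Admissible F 2) →
      ∃ (θ : Node00.Stage13HParams F 2) (h : θ.Provisos₁₃SepCoPH F 2), (θ.ZhUnity F 2 ∧ θ.SlotsNondegenerate₁₃ F 2) ∧ θ.Admissible F 2 ∧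
        ∃ (κ : StepColourData) (c A : ℝ), RemAt F κ θ h c ∧ OneLoopDrift (B12Normalization.stepBal 2 F.L) A (beta0OfJs F κ) ∧
          ∃ w : WorldP, 2 * (c * B12Normalization.stepBal 2 F.L) + 2 * (|c| * A) ≤ w.βup ∧
            (∃ (θ' : Node00.Stage13HParams F 2) (h' : θ'.Provisos₁₃SepCoPH F 2), θ'.Admissible F 2 ∧
              Node00.datumOfRecord₁₃SepCoPH F 2 θ h = Node00.datumOfRecord₁₃SepCoPH F 2 θ' h' ∧ w.C = (Node00.datumOfRecord₁₃SepCoPH F 2 θ h).C ∧ (0 < w.γ ∧ w.γ ≤ θ'.γ) ∧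
              w.L = (θ'.L : ℝ) ∧ ∀ P : B12.RunParams, w.up P = Node00.upOfRecord₅CS F 2 (θ'.toStage5₁₃CoPH F 2) P) ∧
            ∀ P : B12.RunParams, Nodes (leavesP w P)) :
    Summit.QuantumFields.YangMills.Theses.BalabanUVNodes.StabilityBRunRowsAtRecordR13SepCoPH :=
  stabilityBRunRowsAtRecordR13SepCoPH_of_rung0_runRowsCont fun F hinh => by
    obtain ⟨θ, hP, hU, hθ, κ, c, A, hRem, hdrift, w, hmatch, hR, hnodes⟩ := h F hinh
    exact runRowsContAtSomeRecord13PWS_of_remAt_drift_match θ hP w hU hθ hR hnodes κ hRem hdrift hmatch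

end Registered

end Summit.QuantumFields.YangMills.Theorems.K1V7RDefs

end
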